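import Summits.BirchSwinnertonDyer.BirchSwinnertonDyer.Theses.TameQuarticSolvent
import Summits.BirchSwinnertonDyer.BirchSwinnertonDyer.Theses.TameQuarticManinParity
import Summits.BirchSwinnertonDyer.BirchSwinnertonDyer.Theses.KatoDescentTamePotSupersingular
import Summits.BirchSwinnertonDyer.BirchSwinnertonDyer.Theorems.TameQuarticSolventSolventPairLowerBoundOfLowerHalves
import Summits.BirchSwinnertonDyer.BirchSwinnertonDyer.Theorems.PotSupersingularTameLowerClassTransport
import Literature.NumberTheory.EllipticCurves.AnalyticRankModularityProofs
import HarnessLib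

/-!
# Route `TameQuarticSolvent`, crux `SolventPairLowerBound` (stmt-BirchSwinnertonDyer-21391) —
# the crux and its rank-one lower half (TQMP item 23739) REDUCED TO THE INTRINSIC CLASSES at `3`

HONEST FRAMING. Theorems only; helper (`--supports stmt-BirchSwinnertonDyer-21391`), CONDITIONAL on every
displayed hypothesis; credits nothing toward closing any item; BSD is not proved by any of this. No new
definition, no new named fact, no restatement of a crux (route decls are concluded BY NAME).

WHAT. In the tree's one-sided currency the lower half at `(E, p)` is
`Typed.MissingLowerBoundAt E p := ∃ q, Ш_an(E) = q ∧ ord_p q ≤ ord_p #Ш(E)`; it is FREE when `ord_p q ≤ 0`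
(`N10.missingLowerBoundAt_of_padicValRat_le_zero`: `ord_p #Ш ≥ 0`) and it TRANSPORTS along a `ℚ`-isogeny class
in analytic rank `≤ 1` (Cassels' isogeny invariance of the BSD quotient + Gross–Zagier–Kolyvagin finiteness of
`Ш` + modularity: `TwistComparison.missingLowerBoundAt_of_isIsogenous`). Route KT used this to re-cut its
rank-ZERO lower half `TameLowerHalfRankZero` (19981) to the honest open core `TameLowerIntrinsicNonCM` (19618:
the classes ALL of whose globally minimal members have `p ∣ #Ш_an`; `Theorems/PotSupersingularTameLowerClassTransport`,
p439340). This file does the same for analytic rank ONE at `p = 3` on the tame quartic class (t′):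

* §1 `missingLowerBoundAt_of_isIsogenous_unitMember_of_analyticRank_le_one` — route-free, any `p`, any
  reduction type, analytic rank `≤ 1`: a class with a UNIT member (`ord_p #Ш_an(W') ≤ 0` at some globally
  minimal `W' ∼ W`) has the lower half at every member (p439340's `…_rankZero_…` with `r_an = 0` relaxed to
  `r_an ≤ 1`; the transport lemma was already stated in that generality).
* §1 `tprime_rankOne_lowerHalfAtThree_of_intrinsicRows` — the ∀-body of TQMP's `TprimeRankOneLowerAtThree`
  (stmt-BirchSwinnertonDyer-23739) VERBATIM, from Cassels `hCassels`, GZK `hGZK`, modularity `hmod` and the lower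
  half on the INTRINSIC non-CM (t′) rank-one classes at `3` only (every globally minimal member `W'` has
  `ord₃ #Ш_an(W') > 0` whenever that value is rational).
* §2 `tprimeRankOneLowerAtThree_of_intrinsicRows` — 23739 BY NAME from the same inputs;
  `solventPairLowerBound_of_intrinsicRows` / `…_of_intrinsicRows_of_tameLowerIntrinsicNonCM` — the TQS crux 21391
  BY NAME from modularity, Friedberg–Hoffstein Thm B(1) at `3`, Cassels, GZK, the rank-ONE intrinsic rows at `3`
  and the rank-ZERO intrinsic rows at `3` (the latter = KT's EXISTING item 19618 `TameLowerIntrinsicNonCM` read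
  at `p = 3`), through lead g4's `solventPairLowerBound_of_missingLowerBoundAt` (p588900).

NUMBERS (instrument reading, not a proof; Cremona `ecdata` `allbsd` N < 5·10⁵, (t′) at 3 ⟺ `v₃(N) = 2`,
`v₃(j) ≥ 0`, `v₃(Δ_min) ∈ {3, 9}`; script `census/tprime3_census.py` of seat bsd-wall-tqs-p1 g6, cross-checked
against census g3's `ROW2-AT3-SUBBLOCKS-v1.json` flag `all_sha3`): of the 3 533 (t′) rank-one residue classes of
record (54 826 non-CM (t′) rank-one classes in all of `ecdata`), exactly **7** are intrinsic at `3` — 151299b,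
235944v, 248256ca, 295911u, 376065h, 377397a, 395784w (every member `#Ш_an = 9`; `E[3]` irreducible; Kodaira
III/III*) — and 3 526 (resp. 54 819) have a unit member, where the lower half is free-by-transport given the three
print inputs and the numerical unit value; 28 classes have some member with `3 ∣ #Ш_an`. Rank zero (the twist
side, item 19618 at `p = 3`): 920 intrinsic of 4 130 residue classes (928 of 38 480 in all of `ecdata`). For the
7 intrinsic rank-one classes the typed per-class road is the Cassels–Tate certificate slot
`missingLowerBoundAt_of_pow_dvd_of_casselsTate` (`k = 2`: exhibit `(ℤ/3)² ⊆ Ш(E)` by a 3-descent;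
`ord₃ #Ш_an = 2 ≤ k + k % 2`). CAVEAT: in rank one `#Ш_an` involves the regulator, so a «unit member» is a
numerical reading (Cremona's rounded analytic `Ш`), certifiable per curve only through Gross–Zagier-type exact
formulas; the ∀-statements 23739 / 21391 remain OPEN as filed — what is proved here is the class-wide REDUCTION
to the intrinsic rows, and what the numbers locate is where the «⊇»/Eisenstein content of the (t′) rank-one
lower half actually lives.

References: J. W. S. Cassels, J. reine angew. Math. 217 (1965) (Arithmetic VIII); J. S. Milne, Arithmetic
Duality Theorems (2006) Thm. I.7.3; R. L. Miller, LMS J. Comput. Math. 14 (2011) Def. 1.1; S. Friedberg,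
J. Hoffstein, Ann. of Math. 142 (1995) Thm. B(1); C. Breuil, B. Conrad, F. Diamond, R. Taylor, J. Amer. Math.
Soc. 14 (2001) Thm. A; B. Gross, D. Zagier, Invent. Math. 84 (1986); V. A. Kolyvagin, Progr. Math. 87 (1990).
-/

-- D-0017: single-problem summit, so `Summit.BirchSwinnertonDyer.BirchSwinnertonDyer.…` repeats a namespace BY DESIGN.
set_option linter.dupNamespace false
set_option autoImplicit false

noncomputable section

open scoped Classical

open WeierstrassCurve Literature.NumberTheory.EllipticCurves Literature.NumberTheory.EllipticCurves.ModularForms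
  Literature.NumberTheory.EllipticCurves.Rank1Residual Literature.NumberTheory.EllipticCurves.Rank1Residual.Typed
  Summit.BirchSwinnertonDyer.Rank1Residual.Additive Summit.BirchSwinnertonDyer.Rank1Residual

namespace Summit.BirchSwinnertonDyer.BirchSwinnertonDyer.Theorems.SolventPairLowerBound

/-! ## §1 Route-free: unit-member transport in analytic rank ≤ 1, and the (t′) rank-one lower half at 3
from its intrinsic rows -/

/-- **UNIT-MEMBER classes are closed in analytic rank `≤ 1`, any `p`, any reduction type** (route-free,
binder-free): if SOME globally minimal member `W' ∼_ℚ W` of the isogeny class of a curve of analytic rank `≤ 1`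
has `#Ш_an(W') = q'` rational with `ord_p q' ≤ 0`, then `MissingLowerBoundAt W p` — free at `W'`
(`ord_p #Ш(W') ≥ 0`), then Cassels' transport of the lower half along the class (Cassels `hCassels`, GZK `hGZK`,
modularity `hmod`). This is p439340's `missingLowerBoundAt_rankZero_of_isIsogenous_unitMember` with `r_an = 0`
relaxed to `r_an ≤ 1`. CONDITIONAL on the three named published inputs; credits nothing.
[cite: MilneADT2006, Thm. I.7.3] [cite: Cassels1965ArithmeticVIII] [cite: Miller2011LMS, Def. 1.1] -/
theorem missingLowerBoundAt_of_isIsogenous_unitMember_of_analyticRank_le_one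
    (hCassels : bsdRHS_eq_of_isIsogenous) (hGZK : rank_eq_analyticRank_of_analyticRank_le_one)
    (hmod : hasEntireLFunction_rat) (W : WeierstrassCurve ℚ) [W.IsElliptic] [W.IsGloballyMinimal]
    (p : ℕ) [Fact p.Prime] (hr : W.analyticRank ≤ 1)
    (W' : WeierstrassCurve ℚ) [W'.IsElliptic] [W'.IsGloballyMinimal] (hiso : IsIsogenous W W')
    {q' : ℚ} (hq' : shaAn W' = (q' : ℂ)) (hv' : padicValRat p q' ≤ 0) : MissingLowerBoundAt W p := by
  have hr' : W'.analyticRank ≤ 1 := by rw [← analyticRank_eq_of_isIsogenous' hiso]; exact hr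
  exact TwistComparison.missingLowerBoundAt_of_isIsogenous W' W p hCassels hGZK hmod
    hiso.symm_of_charZero hr' (N10.missingLowerBoundAt_of_padicValRat_le_zero W' p hq' hv')

/-- **The (t′) rank-one lower half at `3` — the ∀-body of TQMP's crux `TprimeRankOneLowerAtThree`
(stmt-BirchSwinnertonDyer-23739) VERBATIM — from the published inputs and the lower half on the INTRINSIC
rows only.** Inputs: Cassels `hCassels`, GZK `hGZK`, modularity `hmod` (named published facts) and `hintr` —
the lower half `MissingLowerBoundAt W 3` on the non-CM (t′) analytic-rank-one curves `W` ALL of whose globally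
minimal class members `W'` have `ord₃ #Ш_an(W') > 0` whenever `#Ш_an(W')` is rational (the intrinsic rows: 7 of
the 3 533 residue classes of record, N < 5·10⁵ — module docstring). Every other row is closed by unit-member
transport. CONDITIONAL; the ∀-statement over the intrinsic rows is open; nothing booked.
[cite: MilneADT2006, Thm. I.7.3] [cite: Miller2011LMS, Def. 1.1] -/
theorem tprime_rankOne_lowerHalfAtThree_of_intrinsicRows (hCassels : bsdRHS_eq_of_isIsogenous)
    (hGZK : rank_eq_analyticRank_of_analyticRank_le_one) (hmod : hasEntireLFunction_rat)
    (hintr : ∀ (W : WeierstrassCurve ℚ) [W.IsElliptic] [W.IsGloballyMinimal],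
      ¬ W.HasCM → Addv W 3 → SubTprime W 3 → W.analyticRank = 1 →
      (∀ (W' : WeierstrassCurve ℚ) [W'.IsElliptic] [W'.IsGloballyMinimal], IsIsogenous W W' →
        ∀ q' : ℚ, shaAn W' = (q' : ℂ) → 0 < padicValRat 3 q') →
      MissingLowerBoundAt W 3) :
    ∀ (W : WeierstrassCurve ℚ) [W.IsElliptic] [W.IsGloballyMinimal],
      ¬ W.HasCM → Addv W 3 → SubTprime W 3 → W.analyticRank = 1 → MissingLowerBoundAt W 3 := by
  intro W _ _ hcm hadd hT hr
  by_cases hunit : ∃ (W' : WeierstrassCurve ℚ) (_ : W'.IsElliptic) (_ : W'.IsGloballyMinimal),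
      IsIsogenous W W' ∧ ∃ q' : ℚ, shaAn W' = (q' : ℂ) ∧ padicValRat 3 q' ≤ 0
  · obtain ⟨W', hW', hM', hiso, q', hq', hv'⟩ := hunit
    haveI := hW'
    haveI := hM'
    exact missingLowerBoundAt_of_isIsogenous_unitMember_of_analyticRank_le_one hCassels hGZK hmod W 3
      (by omega) W' hiso hq' hv'
  · refine hintr W hcm hadd hT hr fun W' _ _ hiso q' hq' ↦ ?_
    by_contra hle
    exact hunit ⟨W', inferInstance, inferInstance, hiso, q', hq', not_lt.mp hle⟩

/-- **The (t′) rank-ZERO lower half at `3` on NON-CM rows from the intrinsic rows** (route-free; the `p = 3`,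
non-CM reading of p439340's `tprime_lowerHalf_of_intrinsicNonCMRows` WITHOUT its CM input, which the twist rows
of the TQS crux do not need): Cassels `hCassels`, GZK `hGZK`, modularity `hmod`, and the lower half on the non-CM
(t′) rank-zero curves all of whose globally minimal class members have `ord₃ #Ш_an > 0` (920 of the 4 130 residue
classes of record) give the lower half on every non-CM (t′) rank-zero row at `3`. CONDITIONAL; nothing booked.
[cite: MilneADT2006, Thm. I.7.3] [cite: Miller2011LMS, Def. 1.1] -/
theorem tprime_rankZero_lowerHalfAtThree_nonCM_of_intrinsicRows (hCassels : bsdRHS_eq_of_isIsogenous)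
    (hGZK : rank_eq_analyticRank_of_analyticRank_le_one) (hmod : hasEntireLFunction_rat)
    (hintr0 : ∀ (W : WeierstrassCurve ℚ) [W.IsElliptic] [W.IsGloballyMinimal],
      ¬ W.HasCM → Addv W 3 → SubTprime W 3 → W.analyticRank = 0 →
      (∀ (W' : WeierstrassCurve ℚ) [W'.IsElliptic] [W'.IsGloballyMinimal], IsIsogenous W W' →
        ∀ q' : ℚ, shaAn W' = (q' : ℂ) → 0 < padicValRat 3 q') →
      MissingLowerBoundAt W 3) :
    ∀ (W : WeierstrassCurve ℚ) [W.IsElliptic] [W.IsGloballyMinimal],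
      ¬ W.HasCM → Addv W 3 → SubTprime W 3 → W.analyticRank = 0 → MissingLowerBoundAt W 3 := by
  intro W _ _ hcm hadd hT hr
  by_cases hunit : ∃ (W' : WeierstrassCurve ℚ) (_ : W'.IsElliptic) (_ : W'.IsGloballyMinimal),
      IsIsogenous W W' ∧ ∃ q' : ℚ, shaAn W' = (q' : ℂ) ∧ padicValRat 3 q' ≤ 0
  · obtain ⟨W', hW', hM', hiso, q', hq', hv'⟩ := hunit
    haveI := hW'
    haveI := hM'
    exact missingLowerBoundAt_of_isIsogenous_unitMember_of_analyticRank_le_one hCassels hGZK hmod W 3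
      (by omega) W' hiso hq' hv'
  · refine hintr0 W hcm hadd hT hr fun W' _ _ hiso q' hq' ↦ ?_
    by_contra hle
    exact hunit ⟨W', inferInstance, inferInstance, hiso, q', hq', not_lt.mp hle⟩

/-! ## §2 By name: TQMP 23739 and the TQS crux 21391 from the intrinsic rows -/

/-- **TQMP's `TprimeRankOneLowerAtThree` (stmt-BirchSwinnertonDyer-23739) BY NAME from its intrinsic rows.**
GIVEN Cassels `hCassels`, GZK `hGZK`, modularity in the newform shape `hmod` (`exists_isNewformOf`, turned into
`hasEntireLFunction_rat` by `hasEntireLFunction_rat_of_exists_isNewformOf`) and the lower half on the intrinsic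
non-CM (t′) rank-one rows at `3` (`hintr`), the route decl holds. CONDITIONAL; credits nothing; the item stays
open (its honest open core is `hintr`). [cite: MilneADT2006, Thm. I.7.3] [cite: Miller2011LMS, Def. 1.1]
[cite: BreuilConradDiamondTaylor2001, Thm. A] -/
theorem tprimeRankOneLowerAtThree_of_intrinsicRows (hCassels : bsdRHS_eq_of_isIsogenous)
    (hGZK : rank_eq_analyticRank_of_analyticRank_le_one) (hmod : exists_isNewformOf)
    (hintr : ∀ (W : WeierstrassCurve ℚ) [W.IsElliptic] [W.IsGloballyMinimal],
      ¬ W.HasCM → Addv W 3 → SubTprime W 3 → W.analyticRank = 1 →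
      (∀ (W' : WeierstrassCurve ℚ) [W'.IsElliptic] [W'.IsGloballyMinimal], IsIsogenous W W' →
        ∀ q' : ℚ, shaAn W' = (q' : ℂ) → 0 < padicValRat 3 q') →
      MissingLowerBoundAt W 3) :
    Summit.BirchSwinnertonDyer.BirchSwinnertonDyer.Theses.TameQuarticManinParity.TprimeRankOneLowerAtThree := by
  intro W _ _ hcm hadd hT hr
  exact tprime_rankOne_lowerHalfAtThree_of_intrinsicRows hCassels hGZK
    (hasEntireLFunction_rat_of_exists_isNewformOf hmod) hintr W hcm hadd hT hr

/-- **The TQS crux `SolventPairLowerBound` (stmt-BirchSwinnertonDyer-21391) BY NAME from the intrinsic rows at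
`3` in both ranks.** GIVEN modularity `hmod`, Friedberg–Hoffstein Thm B(1) over `ℚ` with ramification prescribed
at `3` (`hFH`), Cassels `hCassels`, GZK `hGZK`, the lower half on the intrinsic non-CM (t′) rank-ONE rows at `3`
(`hintr1`, 7 of 3 533 residue classes of record) and on the intrinsic non-CM (t′) rank-ZERO rows at `3`
(`hintr0`, 920 of 4 130), the route decl holds: lead g4's `solventPairLowerBound_of_missingLowerBoundAt` fed
with §1. CONDITIONAL; credits nothing; the item stays open. [cite: FriedbergHoffstein1995, Thm. B (1)]
[cite: MilneADT2006, Thm. I.7.3] [cite: Miller2011LMS, Def. 1.1] -/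
theorem solventPairLowerBound_of_intrinsicRows (hmod : exists_isNewformOf)
    (hFH : friedbergHoffstein_exists_pos_twist_ne_zero_ramifiedAtThree)
    (hCassels : bsdRHS_eq_of_isIsogenous) (hGZK : rank_eq_analyticRank_of_analyticRank_le_one)
    (hintr1 : ∀ (W : WeierstrassCurve ℚ) [W.IsElliptic] [W.IsGloballyMinimal],
      ¬ W.HasCM → Addv W 3 → SubTprime W 3 → W.analyticRank = 1 →
      (∀ (W' : WeierstrassCurve ℚ) [W'.IsElliptic] [W'.IsGloballyMinimal], IsIsogenous W W' →
        ∀ q' : ℚ, shaAn W' = (q' : ℂ) → 0 < padicValRat 3 q') →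
      MissingLowerBoundAt W 3)
    (hintr0 : ∀ (W : WeierstrassCurve ℚ) [W.IsElliptic] [W.IsGloballyMinimal],
      ¬ W.HasCM → Addv W 3 → SubTprime W 3 → W.analyticRank = 0 →
      (∀ (W' : WeierstrassCurve ℚ) [W'.IsElliptic] [W'.IsGloballyMinimal], IsIsogenous W W' →
        ∀ q' : ℚ, shaAn W' = (q' : ℂ) → 0 < padicValRat 3 q') →
      MissingLowerBoundAt W 3) :
    Summit.BirchSwinnertonDyer.BirchSwinnertonDyer.Theses.TameQuarticSolvent.SolventPairLowerBound :=
  have hL : hasEntireLFunction_rat := hasEntireLFunction_rat_of_exists_isNewformOf hmod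
  solventPairLowerBound_of_missingLowerBoundAt hmod hFH
    (tprime_rankOne_lowerHalfAtThree_of_intrinsicRows hCassels hGZK hL hintr1)
    (tprime_rankZero_lowerHalfAtThree_nonCM_of_intrinsicRows hCassels hGZK hL hintr0)

/-- **The same with the rank-zero core taken BY NAME from route KT's EXISTING item** `TameLowerIntrinsicNonCM`
(stmt-BirchSwinnertonDyer-19618, all odd additive tame (t′) primes; read here at `p = 3`): GIVEN modularity,
Friedberg–Hoffstein at `3`, Cassels, GZK, the rank-ONE intrinsic rows at `3` (`hintr1`) and 19618 (`h0`), the TQS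
crux `SolventPairLowerBound` holds. With `tprimeRankOneLowerAtThree_of_solventPairLowerBound_of_tprimeRankZeroUpperAtThree`
(same folder) this pins the crux between its honest cores: 21391 ⟸ {r1 intrinsic rows @3, 19618@3, PUB⁴} and
21391 ∧ 21393 ⟹ 23739. CONDITIONAL; credits nothing. [cite: FriedbergHoffstein1995, Thm. B (1)]
[cite: MilneADT2006, Thm. I.7.3] [cite: Miller2011LMS, Def. 1.1] -/
theorem solventPairLowerBound_of_intrinsicRows_of_tameLowerIntrinsicNonCM (hmod : exists_isNewformOf)
    (hFH : friedbergHoffstein_exists_pos_twist_ne_zero_ramifiedAtThree)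
    (hCassels : bsdRHS_eq_of_isIsogenous) (hGZK : rank_eq_analyticRank_of_analyticRank_le_one)
    (hintr1 : ∀ (W : WeierstrassCurve ℚ) [W.IsElliptic] [W.IsGloballyMinimal],
      ¬ W.HasCM → Addv W 3 → SubTprime W 3 → W.analyticRank = 1 →
      (∀ (W' : WeierstrassCurve ℚ) [W'.IsElliptic] [W'.IsGloballyMinimal], IsIsogenous W W' →
        ∀ q' : ℚ, shaAn W' = (q' : ℂ) → 0 < padicValRat 3 q') →
      MissingLowerBoundAt W 3)
    (h0 : Summit.BirchSwinnertonDyer.BirchSwinnertonDyer.Theses.KatoDescentTamePotSupersingular.TameLowerIntrinsicNonCM) :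
    Summit.BirchSwinnertonDyer.BirchSwinnertonDyer.Theses.TameQuarticSolvent.SolventPairLowerBound :=
  solventPairLowerBound_of_intrinsicRows hmod hFH hCassels hGZK hintr1
    (fun W _ _ hcm hadd hT hr0 hin => h0 W 3 hr0 (by norm_num) hadd hT hcm hin)

end Summit.BirchSwinnertonDyer.BirchSwinnertonDyer.Theorems.SolventPairLowerBound

end
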